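import Literature.AlgebraicTopology.SingularHomology.RelativeMayerVietorisPairs
import HarnessLib

/-!
# `H_{q+1}(W | S)` is generated by the pieces of a finite open cover of `W ∩ S` when
# `H_q(· | S) = 0` on all open sets

A. Hatcher, *Algebraic Topology* (2002), §2.2 p. 152 (relative Mayer–Vietoris) and §3.3, proof of
Lemma 3.27 (the induction over finite unions, then arbitrary open sets): let `S ⊆ X` be closed and
suppose the local homology `H_q(W | S) = H_q(W, W ∖ S)` vanishes for EVERY open `W ⊆ X` (as the
tree proves below the codimension for locally flat `S`, `LocallyFlatComplement` /
`Barriers/HodgeConjecture/IntegralCoefficientsCurveSemipurity`). Then for `W` open and open sets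
`B i ⊆ W`, `i ∈ T` finite, covering `W ∩ S`, **every class of `H_{q+1}(W | S)` is a sum of images
of classes of the `H_{q+1}(B i | S)`** (`localHomologyOfSet_mem_iSup_range_of_finite_cover`).
Induction on `T`: write `W ∩ S ⊆ U ∪ V` with `U = ⋃_{i ∈ T} B i ∪ (W ∖ S)` and `V = B a`; by
excision off `S` (`localHomologyOfSet.isIso_map_subsetInclusion_of_inter_subset`)
`H(U ∪ V | S) ≅ H(W | S)`, and by the relative Mayer–Vietoris sequence
(`pairMV.hDiff_surjective_of_isZero`, using `H_q(U ∩ V | S) = 0`) every class of `H_{q+1}(U ∪ V | S)`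
is a difference of images from `U` and `V`.

This is the generation step, in the Thom degree `q + 1 = codim`, of the local-to-global argument
for fundamental classes of locally flat closed subsets (consumer: the cyclicity of
`H₄(U, U ∖ S; ℤ)` for the smooth part of a curve on a threefold,
`Barriers/HodgeConjecture/IntegralCoefficientsCurvePurityHomology`). Everything is proved; no named
facts, no definitions.

## References

* [HatcherAT2002] A. Hatcher, Algebraic Topology, CUP 2002, §2.2 p. 152, §3.3 proof of Lemma 3.27.
-/

noncomputable section

open CategoryTheory Limits Set

universe u v

namespace Literature.AlgebraicTopology.SingularHomology

variable (R : Type v) [CommRing R] (M : Type v) [AddCommGroup M] [Module R M]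
variable {X : Type u} [TopologicalSpace X] {S : Set X}

/-- The maps of pairs compose: `(B ⊆ U ⊆ W)` gives `ι_{U,W} ∘ ι_{B,U} = ι_{B,W}` on `H(· | S)`.
[folklore] -/
theorem localHomologyOfSet_map_comp_map {B U W : Set X} (h₁ : B ⊆ U) (h₂ : U ⊆ W) (n : ℕ) :
    relativeSingularHomology.map R M (subsetInclusion h₁) (relOpenMV.mapsTo_inclusion_compl h₁ S) n ≫
      relativeSingularHomology.map R M (subsetInclusion h₂) (relOpenMV.mapsTo_inclusion_compl h₂ S) n =
      relativeSingularHomology.map R M (subsetInclusion (h₁.trans h₂))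
        (relOpenMV.mapsTo_inclusion_compl (h₁.trans h₂) S) n := by
  rw [← relativeSingularHomology.map_comp]
  rfl

/-- **`H_{q+1}(W | S)` is generated by a finite open cover of `W ∩ S` when `H_q(· | S) ≡ 0` on open
sets** (Hatcher 2002, §3.3 proof of Lemma 3.27, the finite-union induction, in the Thom degree):
for `S` closed, `H_q(W' | S) = 0` for all open `W'`, and open `B i ⊆ W` (`i ∈ T` finite) with
`W ∩ S ⊆ ⋃_{i ∈ T} B i`, every `z ∈ H_{q+1}(W | S)` lies in the sum of the images of the
`H_{q+1}(B i | S) → H_{q+1}(W | S)`. [cite: HatcherAT2002, §2.2 p. 152 and §3.3 proof of Lemma 3.27] -/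
theorem localHomologyOfSet_mem_iSup_range_of_finite_cover (hS : IsClosed S) {q : ℕ}
    (hvan : ∀ W' : Set X, IsOpen W' → IsZero (localHomologyOfSet R M (↥W') (Subtype.val ⁻¹' S) q))
    {ι : Type*} (B : ι → Set X) (hB : ∀ i, IsOpen (B i)) (T : Finset ι) :
    ∀ (W : Set X), IsOpen W → W ∩ S ⊆ (⋃ i ∈ T, B i) → ∀ hBW : ∀ i ∈ T, B i ⊆ W,
      ∀ z : localHomologyOfSet R M (↥W) (Subtype.val ⁻¹' S) (q + 1),
        z ∈ ⨆ (i : ι) (hi : i ∈ T), LinearMap.range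
          (relativeSingularHomology.map R M (subsetInclusion (hBW i hi))
            (relOpenMV.mapsTo_inclusion_compl (hBW i hi) S) (q + 1)).hom := by
  classical
  induction T using Finset.induction_on with
  | empty =>
    intro W hW hWS hBW z
    -- `W ∩ S = ∅`: the group vanishes
    have h0 : (Subtype.val ⁻¹' S : Set ↥W) = ∅ := by
      ext x
      simp only [mem_preimage, mem_empty_iff_false, iff_false]
      intro hx
      simpa using hWS ⟨x.2, hx⟩
    have hz : IsZero (localHomologyOfSet R M (↥W) (Subtype.val ⁻¹' S) (q + 1)) := by
      rw [h0]
      change IsZero (relativeSingularHomology R M (↥W) (∅ : Set ↥W)ᶜ (q + 1))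
      rw [Set.compl_empty]
      exact isZero_relativeSingularHomology_univ R M (q + 1)
    haveI := ModuleCat.subsingleton_of_isZero hz
    rw [Subsingleton.elim z 0]
    exact Submodule.zero_mem _
  | @insert a T haT ih =>
    intro W hW hWS hBW z
    -- the two open pieces
    let U : Set X := (⋃ i ∈ T, B i) ∪ (W ∩ Sᶜ)
    let V : Set X := B a
    have hU : IsOpen U := (isOpen_biUnion fun i _ ↦ hB i).union (hW.inter hS.isOpen_compl)
    have hV : IsOpen V := hB a
    have hUW : U ⊆ W := by
      rintro x (hx | hx)
      · obtain ⟨i, hi, hxi⟩ := mem_iUnion₂.1 hx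
        exact hBW i (Finset.mem_insert_of_mem hi) hxi
      · exact hx.1
    have hVW : V ⊆ W := hBW a (Finset.mem_insert_self a T)
    have hUVW : U ∪ V ⊆ W := union_subset hUW hVW
    have hUS : U ∩ S ⊆ ⋃ i ∈ T, B i := by
      rintro x ⟨hx | hx, hxS⟩
      · exact hx
      · exact absurd hxS hx.2
    have hBU : ∀ i ∈ T, B i ⊆ U := fun i hi x hx ↦ Or.inl (mem_iUnion₂.2 ⟨i, hi, hx⟩)
    have hcov : W ∩ S ⊆ U ∪ V := by
      rintro x ⟨hxW, hxS⟩
      have hx := hWS ⟨hxW, hxS⟩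
      rw [Finset.set_biUnion_insert] at hx
      rcases hx with hx | hx
      · exact Or.inr hx
      · exact Or.inl (Or.inl hx)
    -- excision off `S`: `H(U ∪ V | S) ≅ H(W | S)`
    haveI hE := localHomologyOfSet.isIso_map_subsetInclusion_of_inter_subset R M (hU.union hV) hS
      hUVW hcov (q + 1)
    obtain ⟨z', rfl⟩ := (ConcreteCategory.bijective_of_isIso
      (relativeSingularHomology.map R M (subsetInclusion hUVW)
        (relOpenMV.mapsTo_inclusion_compl hUVW S) (q + 1))).2 z
    -- relative Mayer–Vietoris: `z' = ι_U y - ι_V y'`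
    obtain ⟨⟨y, y'⟩, hyy⟩ := pairMV.hDiff_surjective_of_isZero R M hU hV hS q
      (hvan (U ∩ V) (hU.inter hV)) z'
    rw [pairMV.hDiff_apply] at hyy
    rw [← hyy, map_sub, ← ModuleCat.comp_apply, ← ModuleCat.comp_apply,
      localHomologyOfSet_map_comp_map, localHomologyOfSet_map_comp_map]
    -- the two terms
    refine Submodule.sub_mem _ ?_ ?_
    · -- from `U`: the induction hypothesis, pushed forward to `W`
      have hy := ih U hU hUS hBU y
      have hmap : Submodule.map (relativeSingularHomology.map R M (subsetInclusion hUW)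
          (relOpenMV.mapsTo_inclusion_compl hUW S) (q + 1)).hom
          (⨆ (i : ι) (hi : i ∈ T), LinearMap.range
            (relativeSingularHomology.map R M (subsetInclusion (hBU i hi))
              (relOpenMV.mapsTo_inclusion_compl (hBU i hi) S) (q + 1)).hom) ≤
          ⨆ (i : ι) (hi : i ∈ insert a T), LinearMap.range
            (relativeSingularHomology.map R M (subsetInclusion (hBW i hi))
              (relOpenMV.mapsTo_inclusion_compl (hBW i hi) S) (q + 1)).hom := by
        rw [Submodule.map_iSup]
        refine iSup_le fun i ↦ ?_
        rw [Submodule.map_iSup]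
        refine iSup_le fun hi ↦ ?_
        rw [← LinearMap.range_comp, ← ModuleCat.hom_comp, localHomologyOfSet_map_comp_map]
        exact le_iSup_of_le i (le_iSup_of_le (Finset.mem_insert_of_mem hi) le_rfl)
      exact hmap (Submodule.mem_map_of_mem hy)
    · -- from `V = B a`
      exact Submodule.mem_iSup_of_mem a (Submodule.mem_iSup_of_mem (Finset.mem_insert_self a T)
        (LinearMap.mem_range_self _ y'))

end Literature.AlgebraicTopology.SingularHomology

end
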